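import Summits.QuantumFields.YangMills.Theorems.UnitScaleTiltProp7CornerFrameLegsLetters
import Literature.MathematicalPhysics.QuantumFieldTheory.Balaban1983to89.B8Lemma1NonAbelian
import Literature.MathematicalPhysics.QuantumFieldTheory.Balaban1983to89.B7Prop10InLambda
import Literature.MathematicalPhysics.QuantumFieldTheory.Balaban1983to89.B7Prop1Local
import HarnessLib

/-!
# `UnitScaleTiltProp7CornerFrameLegsStepZd` — LANE II (R-LEGS), brick (Br-5) on `ℤᵈ`: THE POINTWISE ONE-STEP LEGS INEQUALITY FOR ★routeR-w2's DERIVATIVE RECURSION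
# `D′(z) = c•Σ_r [ (R_{0,L•z}Y)(Γ_r) + R(V(L•z; Γ_r))·D(L•z + r) ]` — at every coarse site `z` and direction `μ`, the coarse covariant difference `D′(z) − R(T(z,μ))D′(z + e_μ)` is bounded by
# `‖c‖` times the sum over the box of: `L` unit covariant differences of `D` (telescope), `L` unit covariant differences of `Y` per tree bond (source), and three DISPLAYED curvature letters
# (straight-vs-`T`, thin rectangles, big rectangles) times masses — crux `MinimiserStabilityRegPr` (stmt-QuantumFields-19200), EX lane, hN06 LANE II (QB)∕(QH1) supplier (R-LEGS);
# `--supports stmt-QuantumFields-19200 --as helper`, count-neutral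

Cell `ym3-torus` (HUMAN RULING D-0037: YM₃ on T³ is ladder rung R3 — NOT d = 4, NOT infinite volume, NOT a mass gap, NOT the Clay problem), width seat `ym-ust-20520-w4` (g12), pen of the
curved row `rlegs`.  THEOREMS ONLY (0 `def`, 0 `sorry`); nothing here claims (R-LEGS-cov), (QB), (QH1), (REC), `hN06`, EX or the crux.

THE SHAPE.  `V` a `U1`-valued level-`l` transporter field on `ℤᵈ` (at the member: the comb tower `avgIter L W♯ l`), `T` the level-`(l+1)` transporters (member: `avgIter L W♯ (l+1)`), `Y` a bond
field (member: the single-bar derivative `D[tildIter … l]·A`), `D`, `D′` site fields (member: `D[vcov … l]·A`, `D[vcov … (l+1)]·A`) tied by the RECURSION `hrec` at EVERY label (member: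
✓`Prop7CombFrameLinearResponseOfRegPr.fderiv_vcov_succ_apply_tsum_of_regPr`, `c = (card (Fin d → Fin L))⁻¹`).  The rung across `L` fine steps is the straight transport
`ρ_y := V(y; L steps e_μ) = hol V y (replicate L (μ, true))`.  Curvature letters (DISPLAYED, discharged at the member by lattice Stokes + [B7] (47)): `δ₀ ≥ ‖ρ_{L•z} − T(z,μ)‖`,
`δ ≥ ‖V(y,κ)·ρ_{y+e_κ} − ρ_y·V(y + L•e_μ, κ)‖` (thin `L × 1` rectangles), `δ₁ ≥ ‖V(L•z; Γ_r)·ρ_{L•z+r} − T(z,μ)·V(L•(z+e_μ); Γ_r)‖` (the box rectangles).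

* §3–§4 (the box device for the source sums) `asum_eq_toAdd_hol`, ★`asum_treeWord_congr` (lit ✓`hol_treeWord_congr` read additively over `Multiplicative ℝ`), `exists_boxVec_of_inBox`,
  ★★`asum_treeWord_boxVec_le`∕`sq_asum_treeWord_boxVec_le` — `(asum f q Γ_r)² ≤ (d·L)²·Σ_{s,κ} f(q + boxVec L s, κ)²` for `f ≥ 0`.
* ★★★ `norm_legs_succ_le` — `‖D′(z) − R(T(z,μ))D′(z + e_μ)‖ ≤ ‖c‖·Σ_r [ Σ_{b⊂Γ_r} Σ_{t<L} ‖∇_μ Y(b + t•e_μ)‖ + 2·((#Γ_r)·δ + δ₀)·Σ_{b⊂Γ_r + L•e_μ}‖Y(b)‖ + Σ_{t<L}‖∇_μ D(L•z + r + t•e_μ)‖ + 2δ₁·‖D(L•z + L•e_μ + r)‖ ]`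
  (`∇_μ X(x) := X(x) − R(V(x,μ))X(x + e_μ)` written out; `Σ_{b⊂Γ}` = lit `asum` along the forward tree word).
HONEST SCOPE.  `ℤᵈ` algebra over ✓`Prop7CornerFrameLegsLetters`; the `ℓ²` summation over one period cell with multiplicities, the Stokes discharge of `δ₀ δ δ₁`, the gradient rows of `Y` and the
member knit are the next bricks.  Rung R3; nothing of the crux ∕ the gap is claimed.

References: T. Bałaban, CMP 98 (1985) 17–51 [Balaban1985Averaging] ((9) p.18, (47) p.25, (56)–(58) p.27, (97) p.32, (110)–(112) p.34, (160) p.42); CMP 99 (1985) 389–434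
[Balaban1985BackgroundPropagators] ((3.14)–(3.15) p.393).
-/

set_option autoImplicit false

noncomputable section

open scoped BigOperators

namespace Summit.QuantumFields.YangMills.Theorems.Prop7CornerFrameLegsStepZd

open Literature.MathematicalPhysics.QuantumFieldTheory.Balaban1983to89
open B7Prop1Explicit (Site Letter e hol hol_cons hol_nil stepHol U1 mem_U1 stepHol_mem hol_mem asum asum_nil asum_cons stepA treeWord boxVec length_treeWord l1_boxVec_le)
open B7Eq78Linearization (conjR conjR_apply conjR_add conjR_sub)
open B7Prop3GeneralRotated (tsum norm_conjR_le)
open B8Lemma1NonAbelian (forward_of_mem_treeWord)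
open B7Prop10InLambda (treeWord_boxVec_pos)
open B7Prop1Local (InBox AgreeOn hol_treeWord_congr)
open Summit.QuantumFields.YangMills.Theorems.Prop7CornerFrameLegsLetters

variable {d : ℕ} {𝔸 : Type*} [NormedRing 𝔸] [NormOneClass 𝔸] [NormedAlgebra ℂ 𝔸]

/-! ## §1 Small letters on forward `asum`s (tree words of box vectors are forward: lit ✓`B7Prop10InLambda.treeWord_boxVec_pos`) -/

omit [NormOneClass 𝔸] [NormedAlgebra ℂ 𝔸] in
/-- Along a forward word, the plain sum of a bond function bounded by a constant `m` is at most `(length)·m`. [folklore] -/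
theorem asum_le_length_mul {f : Site d → Fin d → ℝ} {m : ℝ} (hf : ∀ x κ, f x κ ≤ m) :
    ∀ (x : Site d) (w : List (Letter d)), (∀ l ∈ w, l.2 = true) → asum f x w ≤ w.length * m
  | x, [], _ => by simp
  | x, l :: w, hw => by
    have hl : l.2 = true := hw l (by simp)
    have hw' : ∀ l' ∈ w, l'.2 = true := fun l' hl' => hw l' (by simp [hl'])
    rw [asum_cons, List.length_cons, Nat.cast_succ, add_mul, one_mul, add_comm ((w.length : ℝ) * m)]
    have hs : stepA f x l = f x l.1 := by unfold stepA; rw [if_pos hl]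
    rw [hs]
    exact add_le_add (hf _ _) (asum_le_length_mul hf _ w hw')

omit [NormOneClass 𝔸] [NormedAlgebra ℂ 𝔸] in
/-- Monotonicity of the forward plain sum in the bond function. [folklore] -/
theorem asum_mono {f g : Site d → Fin d → ℝ} (hfg : ∀ x κ, f x κ ≤ g x κ) :
    ∀ (x : Site d) (w : List (Letter d)), (∀ l ∈ w, l.2 = true) → asum f x w ≤ asum g x w
  | x, [], _ => by simp
  | x, l :: w, hw => by
    have hl : l.2 = true := hw l (by simp)
    have hw' : ∀ l' ∈ w, l'.2 = true := fun l' hl' => hw l' (by simp [hl'])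
    rw [asum_cons, asum_cons]
    have hs : ∀ (h : Site d → Fin d → ℝ), stepA h x l = h x l.1 := fun h => by unfold stepA; rw [if_pos hl]
    rw [hs, hs]
    exact add_le_add (hfg _ _) (asum_mono hfg _ w hw')

/-! ## §2 ★★★ The pointwise one-step legs inequality -/

/-- ★★★ **THE POINTWISE ONE-STEP LEGS INEQUALITY ON `ℤᵈ`.**  Background `V` and next-level transporters `T` with values in `U1`; the recursion `hrec` at every label; the three displayed
curvature letters `δ₀ δ δ₁` (`δ₀, δ ≥ 0`).  Then at every coarse label `z` and direction `μ`, with `ρ_y := hol V y (replicate L (μ,true))`, `Γ_r := treeWord (boxVec L r)`: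
`‖D′(z) − R(T(z,μ))D′(z + e_μ)‖ ≤ ‖c‖·Σ_r [ asum (y κ ↦ Σ_{t<L} ‖Y(y + t•e_μ, κ) − R(V(y + t•e_μ, μ))Y(y + (t+1)•e_μ, κ)‖) (L•z) Γ_r`
`  + 2·((#Γ_r)·δ + δ₀)·asum ‖Y‖ (L•z + L•e_μ) Γ_r + Σ_{t<L} ‖D(L•z + r + t•e_μ) − R(V(·,μ))D(· + e_μ)‖ + 2δ₁·‖D(L•z + L•e_μ + r)‖ ]`.
Proof: ✓`norm_legsStep_le` at the two recursions, ✓`norm_tsum_sub_conjR_tsum_shift_le` (rungs `ρ`) + ✓`norm_conjR_sub_conjR_le` (`ρ_{L•z}` vs `T`) for the source, ✓`norm_sub_conjR_hol_replicate_le`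
for the two straight telescopes. [cite: Balaban1985Averaging, (97) p.32, (56)-(58) p.27, (110)-(112) p.34, (160) p.42; Balaban1985BackgroundPropagators, (3.14)-(3.15) p.393] -/
theorem norm_legs_succ_le (L : ℕ) {V T : Site d → Fin d → 𝔸ˣ} (hV : ∀ x κ, V x κ ∈ U1 𝔸) (hT : ∀ x κ, T x κ ∈ U1 𝔸)
    (Y : Site d → Fin d → 𝔸) (D D' : Site d → 𝔸) (c : ℂ)
    (hrec : ∀ z : Site d, D' z = c • ∑ r : Fin d → Fin L,
      (tsum V Y ((L : ℤ) • z) (treeWord (boxVec L r)) + conjR (hol V ((L : ℤ) • z) (treeWord (boxVec L r))) (D ((L : ℤ) • z + boxVec L r))))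
    (μ : Fin d) {δ₀ δ δ₁ : ℝ} (hδ₀0 : 0 ≤ δ₀) (hδn : 0 ≤ δ)
    (z : Site d)
    (hδ₀ : ‖((hol V ((L : ℤ) • z) (List.replicate L (μ, true)) : 𝔸ˣ) : 𝔸) - (T z μ : 𝔸)‖ ≤ δ₀)
    (hδ : ∀ (y : Site d) (κ : Fin d),
      ‖(V y κ : 𝔸) * ((hol V (y + e κ) (List.replicate L (μ, true)) : 𝔸ˣ) : 𝔸)
          - ((hol V y (List.replicate L (μ, true)) : 𝔸ˣ) : 𝔸) * (V (y + (L : ℤ) • e μ) κ : 𝔸)‖ ≤ δ)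
    (hδ₁ : ∀ r : Fin d → Fin L,
      ‖((hol V ((L : ℤ) • z) (treeWord (boxVec L r)) : 𝔸ˣ) : 𝔸) * ((hol V ((L : ℤ) • z + boxVec L r) (List.replicate L (μ, true)) : 𝔸ˣ) : 𝔸)
          - (T z μ : 𝔸) * ((hol V ((L : ℤ) • (z + e μ)) (treeWord (boxVec L r)) : 𝔸ˣ) : 𝔸)‖ ≤ δ₁) :
    ‖D' z - conjR (T z μ) (D' (z + e μ))‖
      ≤ ‖c‖ * ∑ r : Fin d → Fin L,
          ( asum (fun y κ => ∑ t ∈ Finset.range L, ‖Y (y + (t : ℤ) • e μ) κ - conjR (V (y + (t : ℤ) • e μ) μ) (Y (y + ((t : ℤ) + 1) • e μ) κ)‖)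
              ((L : ℤ) • z) (treeWord (boxVec L r))
            + 2 * (((treeWord (boxVec L r)).length : ℝ) * δ + δ₀) * asum (fun y κ => ‖Y y κ‖) ((L : ℤ) • z + (L : ℤ) • e μ) (treeWord (boxVec L r))
            + ∑ t ∈ Finset.range L, ‖D ((L : ℤ) • z + boxVec L r + (t : ℤ) • e μ)
                - conjR (V ((L : ℤ) • z + boxVec L r + (t : ℤ) • e μ) μ) (D ((L : ℤ) • z + boxVec L r + ((t : ℤ) + 1) • e μ))‖
            + 2 * δ₁ * ‖D ((L : ℤ) • z + (L : ℤ) • e μ + boxVec L r)‖ ) := by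
  -- letters
  set Lz : Site d := (L : ℤ) • z with hLz
  have hLz' : (L : ℤ) • (z + e μ) = Lz + (L : ℤ) • e μ := by rw [hLz, smul_add]
  set ρ : Site d → 𝔸ˣ := fun y => hol V y (List.replicate L (μ, true)) with hρ
  have hρU : ∀ y, ρ y ∈ U1 𝔸 := fun y => hol_mem hV _ _
  have hfw : ∀ r : Fin d → Fin L, ∀ l ∈ treeWord (boxVec L r), l.2 = true := treeWord_boxVec_pos L
  -- the two recursions
  rw [hrec z, hrec (z + e μ), hLz']
  -- the one-step algebra with rungs `s_r := ρ (Lz + r)`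
  refine (norm_legsStep_le c _ _ _ _ (g := fun r => hol V Lz (treeWord (boxVec L r))) (g' := fun r => hol V (Lz + (L : ℤ) • e μ) (treeWord (boxVec L r)))
    (s := fun r => ρ (Lz + boxVec L r)) (T := T z μ) (fun r => hol_mem hV _ _) (fun r => hol_mem hV _ _) (fun r => hρU _) (hT z μ)).trans ?_
  refine mul_le_mul_of_nonneg_left (Finset.sum_le_sum fun r _ => ?_) (norm_nonneg c)
  -- (b) the source: shifted-word comparison with rungs `ρ`, then `ρ_{Lz}` versus `T`
  have hsrc : ‖tsum V Y Lz (treeWord (boxVec L r)) - conjR (T z μ) (tsum V Y (Lz + (L : ℤ) • e μ) (treeWord (boxVec L r)))‖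
      ≤ asum (fun y κ => ∑ t ∈ Finset.range L, ‖Y (y + (t : ℤ) • e μ) κ - conjR (V (y + (t : ℤ) • e μ) μ) (Y (y + ((t : ℤ) + 1) • e μ) κ)‖) Lz (treeWord (boxVec L r))
        + 2 * (((treeWord (boxVec L r)).length : ℝ) * δ + δ₀) * asum (fun y κ => ‖Y y κ‖) (Lz + (L : ℤ) • e μ) (treeWord (boxVec L r)) := by
    -- split `R(T) = R(ρ Lz) + (R(T) − R(ρ Lz))`
    have hcmp := norm_tsum_sub_conjR_tsum_shift_le hV Y (a := fun y κ => ‖Y y κ‖) (fun _ _ => norm_nonneg _) (fun _ _ => le_rfl) ((L : ℤ) • e μ) hρU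
      (G := fun y κ => ‖Y y κ - conjR (ρ y) (Y (y + (L : ℤ) • e μ) κ)‖) (δ := fun _ _ => δ) (fun _ _ => hδn) (fun _ _ => le_rfl)
      (fun y κ => hδ y κ) Lz (treeWord (boxVec L r)) (hfw r)
    have hswap : ‖conjR (ρ Lz) (tsum V Y (Lz + (L : ℤ) • e μ) (treeWord (boxVec L r))) - conjR (T z μ) (tsum V Y (Lz + (L : ℤ) • e μ) (treeWord (boxVec L r)))‖
        ≤ 2 * δ₀ * asum (fun y κ => ‖Y y κ‖) (Lz + (L : ℤ) • e μ) (treeWord (boxVec L r)) := by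
      refine (norm_conjR_sub_conjR_le (hρU Lz) (hT z μ) _).trans ?_
      have h1 := norm_tsum_le_asum hV (A := Y) (a := fun y κ => ‖Y y κ‖) (fun _ _ => le_rfl) (Lz + (L : ℤ) • e μ) (treeWord (boxVec L r)) (hfw r)
      have h0 : 0 ≤ asum (fun y κ => ‖Y y κ‖) (Lz + (L : ℤ) • e μ) (treeWord (boxVec L r)) := asum_nonneg_of_forward (fun _ _ => norm_nonneg _) _ _ (hfw r)
      have := hδ₀
      nlinarith [norm_nonneg (tsum V Y (Lz + (L : ℤ) • e μ) (treeWord (boxVec L r))), norm_nonneg (((hol V Lz (List.replicate L (μ, true)) : 𝔸ˣ) : 𝔸) - (T z μ : 𝔸))]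
    -- the `G`-sum: each bond difference across `L•e_μ` telescopes into `L` unit differences
    have hG : asum (fun y κ => ‖Y y κ - conjR (ρ y) (Y (y + (L : ℤ) • e μ) κ)‖) Lz (treeWord (boxVec L r))
        ≤ asum (fun y κ => ∑ t ∈ Finset.range L, ‖Y (y + (t : ℤ) • e μ) κ - conjR (V (y + (t : ℤ) • e μ) μ) (Y (y + ((t : ℤ) + 1) • e μ) κ)‖) Lz (treeWord (boxVec L r)) :=
      asum_mono (fun y κ => norm_sub_conjR_hol_replicate_le hV (fun x => Y x κ) μ L y) _ _ (hfw r)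
    -- the `δ`-sum along the word is `(length)·δ`
    have hδsum : asum (fun _ _ => δ) Lz (treeWord (boxVec L r)) ≤ ((treeWord (boxVec L r)).length : ℝ) * δ :=
      asum_le_length_mul (fun _ _ => le_rfl) _ _ (hfw r)
    have ha0 : 0 ≤ asum (fun y κ => ‖Y y κ‖) (Lz + (L : ℤ) • e μ) (treeWord (boxVec L r)) := asum_nonneg_of_forward (fun _ _ => norm_nonneg _) _ _ (hfw r)
    calc _ ≤ ‖tsum V Y Lz (treeWord (boxVec L r)) - conjR (ρ Lz) (tsum V Y (Lz + (L : ℤ) • e μ) (treeWord (boxVec L r)))‖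
          + ‖conjR (ρ Lz) (tsum V Y (Lz + (L : ℤ) • e μ) (treeWord (boxVec L r))) - conjR (T z μ) (tsum V Y (Lz + (L : ℤ) • e μ) (treeWord (boxVec L r)))‖ :=
          norm_sub_le_norm_sub_add_norm_sub _ _ _
      _ ≤ _ := by nlinarith [hcmp, hswap, hG, mul_le_mul_of_nonneg_right hδsum ha0]
  -- (a) the old differences telescope along `L` straight steps from `Lz + r`
  have hold : ‖D (Lz + boxVec L r) - conjR (ρ (Lz + boxVec L r)) (D (Lz + (L : ℤ) • e μ + boxVec L r))‖
      ≤ ∑ t ∈ Finset.range L, ‖D (Lz + boxVec L r + (t : ℤ) • e μ) - conjR (V (Lz + boxVec L r + (t : ℤ) • e μ) μ) (D (Lz + boxVec L r + ((t : ℤ) + 1) • e μ))‖ := by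
    have h := norm_sub_conjR_hol_replicate_le hV D μ L (Lz + boxVec L r)
    rwa [show Lz + boxVec L r + (L : ℤ) • e μ = Lz + (L : ℤ) • e μ + boxVec L r by abel] at h
  -- (c) the big-rectangle defect
  have hrect := hδ₁ r
  rw [hLz'] at hrect
  have hD0 := norm_nonneg (D (Lz + (L : ℤ) • e μ + boxVec L r))
  -- assemble the three
  have e1 : (2 : ℝ) * ‖((hol V Lz (treeWord (boxVec L r)) : 𝔸ˣ) : 𝔸) * ((ρ (Lz + boxVec L r) : 𝔸ˣ) : 𝔸) - (T z μ : 𝔸) * ((hol V (Lz + (L : ℤ) • e μ) (treeWord (boxVec L r)) : 𝔸ˣ) : 𝔸)‖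
      * ‖D (Lz + (L : ℤ) • e μ + boxVec L r)‖ ≤ 2 * δ₁ * ‖D (Lz + (L : ℤ) • e μ + boxVec L r)‖ :=
    mul_le_mul_of_nonneg_right (mul_le_mul_of_nonneg_left hrect (by norm_num)) hD0
  linarith [hsrc, hold, e1]

/-! ## §3 `asum` is `hol` over `Multiplicative ℝ` on forward words; locality along tree contours (the box device) -/

/-- On a forward word the plain sum is the (additively written) holonomy of `ofAdd ∘ f` over the group `Multiplicative ℝ`. [folklore] -/
theorem asum_eq_toAdd_hol (f : Site d → Fin d → ℝ) :
    ∀ (x : Site d) (w : List (Letter d)), (∀ l ∈ w, l.2 = true) →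
      asum f x w = Multiplicative.toAdd (hol (fun y κ => Multiplicative.ofAdd (f y κ)) x w)
  | x, [], _ => by simp [asum_nil, hol_nil]
  | x, lt :: w, hw => by
    have hl : lt.2 = true := hw lt (by simp)
    have hw' : ∀ l' ∈ w, l'.2 = true := fun l' hl' => hw l' (by simp [hl'])
    rw [asum_cons, hol_cons, toAdd_mul, asum_eq_toAdd_hol f (x + lt.vec) w hw']
    unfold stepA stepHol
    rw [if_pos hl, if_pos hl]
    rfl

/-- ★ **LOCALITY OF THE PLAIN SUM ALONG A TREE CONTOUR**: if `f` and `f′` agree on every bond with both end points in the box `[lo, hi]`, then for `0 ≤ v` and `p, p + v` in the box,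
`asum f p (treeWord v) = asum f′ p (treeWord v)` (lit ✓`hol_treeWord_congr` read additively). [cite: Balaban1985Averaging, p.24] -/
theorem asum_treeWord_congr {f f' : Site d → Fin d → ℝ} {lo hi : Site d}
    (h : ∀ x κ, InBox lo hi x → InBox lo hi (x + e κ) → f x κ = f' x κ) {v : Site d} (hv : 0 ≤ v)
    (p : Site d) (hp : InBox lo hi p) (hpv : InBox lo hi (p + v)) :
    asum f p (treeWord v) = asum f' p (treeWord v) := by
  have hfw : ∀ l ∈ treeWord v, l.2 = true := fun l hl => by
    have := B8Lemma1NonAbelian.forward_of_mem_treeWord hv hl; rw [this]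
  rw [asum_eq_toAdd_hol f p _ hfw, asum_eq_toAdd_hol f' p _ hfw]
  congr 1
  refine hol_treeWord_congr (G := Multiplicative ℝ) (fun x κ hx hxe => ?_) p v hp hpv
  simp only [h x κ hx hxe]

/-! ## §4 The tree contour of a box offset: plain sums bounded by the box -/

/-- A point of the box `[q, q + boxVec L r]` (`r : Fin d → Fin L`) is `q + boxVec L s` for some `s : Fin d → Fin L`. [folklore] -/
theorem exists_boxVec_of_inBox (L : ℕ) (q : Site d) (r : Fin d → Fin L) {y : Site d} (hy : InBox q (q + boxVec L r) y) :
    ∃ s : Fin d → Fin L, y = q + boxVec L s := by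
  have hnn : ∀ i, 0 ≤ y i - q i := fun i => by have := (hy i).1; linarith
  have hlt : ∀ i, (y i - q i).toNat < L := by
    intro i
    have h2 := (hy i).2
    simp only [Pi.add_apply, boxVec] at h2
    have : y i - q i ≤ ((r i : ℕ) : ℤ) := by linarith
    have hr := (r i).isLt
    omega
  refine ⟨fun i => ⟨(y i - q i).toNat, hlt i⟩, funext fun i => ?_⟩
  simp only [Pi.add_apply, boxVec]
  rw [Int.toNat_of_nonneg (hnn i)]
  ring

/-- ★★ **PLAIN SUMS ALONG `Γ_{q, q + r}` ARE BOUNDED BY THE BOX**: for `f ≥ 0`, `asum f q (treeWord (boxVec L r)) ≤ #Γ_r · √(Σ_{s : Fin d → Fin L} Σ_κ f(q + boxVec L s, κ)²)` — every bond of the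
contour starts at a box point (locality §1 with the box `[q, q + boxVec L r]`), and a nonnegative term is at most the root of the sum of squares. [cite: Balaban1985Averaging, p.24, (111) p.34] -/
theorem asum_treeWord_boxVec_le (L : ℕ) {f : Site d → Fin d → ℝ} (hf : ∀ x κ, 0 ≤ f x κ) (q : Site d) (r : Fin d → Fin L) :
    asum f q (treeWord (boxVec L r))
      ≤ ((treeWord (boxVec L r)).length : ℝ) * Real.sqrt (∑ s : Fin d → Fin L, ∑ κ : Fin d, f (q + boxVec L s) κ ^ 2) := by
  classical
  set M : ℝ := Real.sqrt (∑ s : Fin d → Fin L, ∑ κ : Fin d, f (q + boxVec L s) κ ^ 2) with hM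
  -- localise `f` to the box
  set f' : Site d → Fin d → ℝ := fun y κ => if InBox q (q + boxVec L r) y then f y κ else 0 with hf'
  have hv : (0 : Site d) ≤ boxVec L r := fun i => by simp [boxVec]
  have hq : InBox q (q + boxVec L r) q := fun i => ⟨le_rfl, by simp [boxVec]⟩
  have hqv : InBox q (q + boxVec L r) (q + boxVec L r) := fun i => ⟨by simp [boxVec], le_rfl⟩
  have hloc : asum f q (treeWord (boxVec L r)) = asum f' q (treeWord (boxVec L r)) :=
    asum_treeWord_congr (fun x κ hx _ => by simp only [hf', if_pos hx]) hv q hq hqv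
  rw [hloc]
  -- the localised letter is bounded by `M` everywhere
  have hbd : ∀ y κ, f' y κ ≤ M := by
    intro y κ
    simp only [hf']
    split_ifs with hy
    · obtain ⟨s, rfl⟩ := exists_boxVec_of_inBox L q r hy
      rw [hM, ← Real.sqrt_sq (hf _ κ)]
      refine Real.sqrt_le_sqrt ?_
      calc f (q + boxVec L s) κ ^ 2 ≤ ∑ κ' : Fin d, f (q + boxVec L s) κ' ^ 2 :=
            Finset.single_le_sum (f := fun κ' => f (q + boxVec L s) κ' ^ 2) (fun _ _ => sq_nonneg _) (Finset.mem_univ κ)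
        _ ≤ ∑ s' : Fin d → Fin L, ∑ κ' : Fin d, f (q + boxVec L s') κ' ^ 2 :=
            Finset.single_le_sum (f := fun s' => ∑ κ' : Fin d, f (q + boxVec L s') κ' ^ 2) (fun _ _ => Finset.sum_nonneg fun _ _ => sq_nonneg _) (Finset.mem_univ s)
    · exact Real.sqrt_nonneg _
  exact asum_le_length_mul hbd q _ (treeWord_boxVec_pos L r)

/-- ★★ **THE SQUARED FORM**: `(asum f q Γ_r)² ≤ (d·L)²·Σ_{s,κ} f(q + boxVec L s, κ)²` for `f ≥ 0` (`#Γ_r = ‖boxVec r‖₁ ≤ d·L`). [cite: Balaban1985Averaging, p.24, (111) p.34] -/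
theorem sq_asum_treeWord_boxVec_le (L : ℕ) {f : Site d → Fin d → ℝ} (hf : ∀ x κ, 0 ≤ f x κ) (q : Site d) (r : Fin d → Fin L) :
    asum f q (treeWord (boxVec L r)) ^ 2 ≤ ((d * L : ℕ) : ℝ) ^ 2 * ∑ s : Fin d → Fin L, ∑ κ : Fin d, f (q + boxVec L s) κ ^ 2 := by
  have h := asum_treeWord_boxVec_le L hf q r
  have h0 : 0 ≤ asum f q (treeWord (boxVec L r)) := asum_nonneg_of_forward hf q _ (treeWord_boxVec_pos L r)
  have hS : 0 ≤ ∑ s : Fin d → Fin L, ∑ κ : Fin d, f (q + boxVec L s) κ ^ 2 := Finset.sum_nonneg fun _ _ => Finset.sum_nonneg fun _ _ => sq_nonneg _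
  have hlen : ((treeWord (boxVec L r)).length : ℝ) ≤ ((d * L : ℕ) : ℝ) := by rw [length_treeWord]; exact_mod_cast l1_boxVec_le L r
  calc asum f q (treeWord (boxVec L r)) ^ 2
      ≤ (((treeWord (boxVec L r)).length : ℝ) * Real.sqrt (∑ s : Fin d → Fin L, ∑ κ : Fin d, f (q + boxVec L s) κ ^ 2)) ^ 2 := pow_le_pow_left₀ h0 h 2
    _ = ((treeWord (boxVec L r)).length : ℝ) ^ 2 * ∑ s : Fin d → Fin L, ∑ κ : Fin d, f (q + boxVec L s) κ ^ 2 := by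
        rw [mul_pow, Real.sq_sqrt hS]
    _ ≤ _ := by gcongr


end Summit.QuantumFields.YangMills.Theorems.Prop7CornerFrameLegsStepZd

end
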